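import Literature.NumberTheory.Transcendental.SemistabilityInduction
import Mathlib.LinearAlgebra.Matrix.Rank
import HarnessLib

/-!
# The Semistability Theorem for `M_κ` with at most one elliptic factor, complex multiplication allowed

Topic: `Literature/NumberTheory/Transcendental`. A proofs-only file (theorems only, no
definitions, no named facts) of the unit
`provefact-Literature.NumberTheory.Transcendental.e-2526aebcd4` (fact
`Literature.NumberTheory.Transcendental.ellipticPeriod_not_mem_logSpan`, Huber–Wüstholz 2022,
Thm. 15.3 (1) for the 1-motive `[ℤ^r → 𝔾ₘ^r] ⊕ [0 → E]`: a non-zero period `ω` of an elliptic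
curve over `ℚ̄` is not of the form `β₀ + ∑ βᵢ log αᵢ`).

The tree proves the chain *Philippon's zero estimate on `M_κ` ⟹ Baker–Wüstholz's Semistability
Theorem for `M_κ` (torsion abelian part) ⟹ hyperplane theorem for the quotients of
`G = 𝔾ₐ × 𝔾ₘ^ι × (E♮)^κ` ⟹ analytic subgroup theorem at the period vectors*
(`ClosingDichotomy.dichotomy`, `NumCondFamily.dichotomy'`, `TorsionDichotomy.torsionDichotomy`,
`StableClosing.mem_ker_of_stable`, `SemistabilityInduction.mem_ker_of_semistable_card`,
`SemistableTorsion.GaGmE.hyperplaneTheorem_presTors_of_std_tors`) from the GLOBAL named fact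
`philippon1986_std`, which carries the hypothesis `¬ L.HasCM`: its obstruction subgroup ranges
over the explicit list `GaGmE.Std.SubgroupDataC` of connected algebraic subgroups of
`M_κ = 𝔾ₘ^β × P_κ`, and for a CM curve and `|γ| ≥ 2` elliptic coordinates that list misses the
graphs of complex multiplications. In the whole chain `¬ L.HasCM` is used ONLY to invoke
`philippon1986_std`, always at the same lattice `L`; and the passage to quotients
(`StdQuotients.QuotData`, `SemistableQuotients.GaGmE.QuotData`) and to subgroups
(`StdSubgroups.SubData`) never increases the number of elliptic coordinates
(`nC ≤ |γ|`, from the unimodularity of the adapted bases, proved below). For **at most one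
elliptic factor** the list `SubgroupDataC` is the complete list of connected algebraic subgroups
whether or not `E` has complex multiplication (an extension of `E` by a vector group has no
connected algebraic subgroups other than vector subgroups and the pull-backs of split quotients;
no endomorphism of `E` enters), so Philippon's Théorème 2.1 gives the zero estimate in the form of
`philippon1986_std` for every lattice with algebraic invariants as soon as `|γ| ≤ 1`.

This file therefore re-threads the chain **per lattice**, with Philippon's zero estimate as an
explicit hypothesis at the lattice `L` (the body of `philippon1986_std` at `L`, no CM hypothesis),
keeping the invariant `|γ| ≤ 1` through the induction:

* `Std.dichotomy_of_zeroEstimateAt`, `Std.dichotomy'_of_zeroEstimateAt`,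
  `Std.torsionDichotomy_of_zeroEstimateAt`, `Std.mem_ker_of_stable_of_zeroEstimateAt` — the four
  closing theorems with `(hphil : philippon1986_std) … (hCM : ¬ L.HasCM)` replaced by the zero
  estimate for the one group `M_κ` over `L` at hand (proofs verbatim);
* `Std.QuotData.nC_le_card`, `Std.SubData.nC_le_card`, `GaGmE.QuotData.nC_le_card` — quotients
  and subgroups of a standard model have at most as many elliptic coordinates;
* `Std.mem_ker_of_semistable_card_oneFactor` — the Semistability Theorem for the `M_κ` over `L`
  with `|γ| ≤ 1` at points with torsion abelian part, by the strong induction of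
  `SemistabilityInduction.mem_ker_of_semistable_card`, from the zero estimate for all `M_κ` over
  `L` with `|γ| ≤ 1`; `Std.hyperplane_tors_oneFactor_of_zeroEstimateAt` — its hyperplane form;
* `GaGmE.hyperplaneTheorem_presTors_oneFactor` — transport to the quotients `G/H` of
  `G = 𝔾ₐ × 𝔾ₘ^ι × (E♮)^κ`, `|κ| ≤ 1`, at points with torsion abelian part;
* `GaGmE.periods_oneFactor_of_zeroEstimateAt` — the analytic subgroup theorem at the period
  vectors of `𝔾ₐ × 𝔾ₘ^ι × E♮` over `L` (CM allowed) from the zero estimate over `L`.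

The corollary for `ellipticPeriod_not_mem_logSpan` (all lattices, CM allowed, from Philippon's
zero estimate on the `M_κ` with at most one elliptic factor) is drawn in
`EllipticPeriodLogSpanProofs.lean`. No statement of the tree is modified; nothing is assumed
beyond the displayed hypotheses (D-0026: the zero estimate is an explicit hypothesis, not a new
named fact).

## References

* A. Baker, G. Wüstholz, *Logarithmic Forms and Diophantine Geometry*, New Math. Monogr. 9, CUP
  2007: Thm. 6.1, Thm. 6.15, §6.8 (pp. 115–119). [BakerWustholz2007]
* A. Huber, G. Wüstholz, *Transcendence and Linear Relations of 1-Periods*, Cambridge Tracts 227,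
  CUP 2022: Thm. 6.2 (analytic subgroup theorem, no CM restriction), Thm. 15.3 (1).
  [HuberWustholz2022]
* P. Philippon, *Lemmes de zéros dans les groupes algébriques commutatifs*, Bull. Soc. Math.
  France 114 (1986), 355–383, Théorème 2.1 (any commutative algebraic group; the obstruction is a
  connected algebraic subgroup). [Philippon1986]
* G. Wüstholz, *Algebraische Punkte auf analytischen Untergruppen algebraischer Gruppen*, Ann. of
  Math. 129 (1989), 501–517 (the analytic subgroup theorem, CM allowed).
-/

noncomputable section

open Module Submodule Complex
open scoped PeriodPair

namespace Literature.NumberTheory.Transcendental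

namespace GaGmE

namespace Std

open LiePresentation

/-! ### Elliptic coordinates do not increase under quotients and subgroups -/

/-- A matrix with a right inverse has at least as many columns as rows: if `M P = 1` for
`M ∈ ℤ^{n × κ}` then `n ≤ |κ|` (rank count). [folklore] -/
theorem fin_le_card_of_mul_eq_one {κ : Type} [Fintype κ] {n : ℕ}
    (M : Matrix (Fin n) κ ℤ) (P : Matrix κ (Fin n) ℤ) (h : M * P = 1) : n ≤ Fintype.card κ := by
  calc n = (1 : Matrix (Fin n) (Fin n) ℤ).rank := by rw [Matrix.rank_one, Fintype.card_fin]
    _ = (M * P).rank := by rw [h]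
    _ ≤ M.rank := Matrix.rank_mul_le_left _ _
    _ ≤ Fintype.card κ := Matrix.rank_le_card_width _

/-- Unimodular integer families are short: if every integer vector `t ∈ ℤ^n` is of the form
`b ↦ ∑_k c⁽ᵇ⁾_k p_k` with `p ∈ ℤ^κ`, then `n ≤ |κ|`. [folklore] -/
theorem fin_le_card_of_unimod {κ : Type} [Fintype κ] {n : ℕ} (cv : Fin n → κ → ℤ)
    (h : ∀ t : Fin n → ℤ, ∃ p : κ → ℤ, ∀ b, ∑ k, cv b k * p k = t b) : n ≤ Fintype.card κ := by
  choose p hp using fun b' : Fin n => h (Pi.single b' 1)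
  refine fin_le_card_of_mul_eq_one (Matrix.of fun b k => cv b k) (Matrix.of fun k b' => p b' k) ?_
  ext b b'
  rw [Matrix.mul_apply, Matrix.one_apply]
  simp only [Matrix.of_apply]
  rw [hp b' b, Pi.single_apply]

variable {β γ δ : Type} [Fintype β] [Fintype γ] [Fintype δ]

/-- **A quotient `M_κ/K₀ = M_κ'` has at most `|γ|` elliptic coordinates** (`nC ≤ |γ|`: the
integer homomorphisms `c⁽ᵇ⁾` form a unimodular family in `ℤ^γ`). [folklore] -/
theorem QuotData.nC_le_card {κM : δ → γ → Kbar} {D₀ : SubgroupData β γ δ κM} (Q : QuotData D₀) :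
    Q.nC ≤ Fintype.card γ :=
  fin_le_card_of_unimod Q.cv Q.cv_unimod

/-- **A connected algebraic subgroup `K₀ = M_κ''` has at most `|γ|` elliptic coordinates**
(`nC ≤ |γ|`: the integer vectors `m⁽ᵇ⁾ ∈ C₀^⊥` have an integer left inverse). [folklore] -/
theorem SubData.nC_le_card {κM : δ → γ → Kbar} {D₀ : SubgroupData β γ δ κM} (S : SubData D₀) :
    S.nC ≤ Fintype.card γ := by
  refine fin_le_card_of_mul_eq_one (Matrix.of fun b k => S.mv b k) (Matrix.of fun k b' => S.pC b' k) ?_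
  ext b b'
  rw [Matrix.mul_apply, Matrix.one_apply]
  simp only [Matrix.of_apply]
  exact S.pC_spec b b'

/-! ### The closing theorems from the zero estimate at one lattice -/

section Closing

variable [DecidableEq γ] [DecidableEq β] [DecidableEq δ]

/-- **The dichotomy theorem of Baker's method on `M_κ`, from the zero estimate for this `M_κ`.**
`ClosingDichotomy.dichotomy` with the global named fact `philippon1986_std` (and its hypothesis
`¬ L.HasCM`) replaced by Philippon's zero estimate for the one group variety `M_κ` over the
lattice `L` at hand (hypothesis `hZ`, the body of `philippon1986_std` at `L, β, γ, δ, κ`); same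
proof. Let `Λ` have algebraic invariants, `𝔟 ⊊ Lie M_κ` `ℚ̄`-rational and semistable, `w ∈ 𝔟`
with `exp(w)` algebraic with torsion abelian part, and admissible parameters for every Baker
datum at `w` (`hpar`). Then there is a connected algebraic subgroup datum `K ≠ M_κ`, borderline
for semistability, with a multiple `r·w` (`r ≥ 1`) in `Lie K_ℂ + ker`.
[cite: BakerWustholz2007, §6.8 (pp. 118–119)] [cite: Philippon1986, Thm 2.1] -/
theorem dichotomy_of_zeroEstimateAt (L : PeriodPair) (h₂ : IsAlgebraic ℚ L.g₂)
    (h₃ : IsAlgebraic ℚ L.g₃) (κM : δ → γ → Kbar)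
    (hZ : ∃ c : ℝ, 0 < c ∧ ∀ (𝔟 : Submodule ℂ (β ⊕ (γ ⊕ δ) → ℂ)) (v : β ⊕ (γ ⊕ δ) → ℂ)
        (P : MvPolynomial (Option β × ThetaIdx γ δ) ℂ) (D S T : ℕ),
        0 < Module.finrank ℂ 𝔟 → 1 ≤ D → 1 ≤ S → P.IsHomogeneous D → (∃ w, thetaEval L κM P w ≠ 0) →
        (∀ s : ℕ, s ≤ Fintype.card (β ⊕ (γ ⊕ δ)) * S →
          VanishesAlong 𝔟 (thetaEval L κM P) ((s : ℂ) • v) (Fintype.card (β ⊕ (γ ⊕ δ)) * T + 1)) →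
        ∃ K : SubgroupDataC β γ δ κM,
          (∃ w₀, ∀ w ∈ K.tangent, thetaEval L κM P (w₀ + w) = 0) ∧
          (Nat.choose (T + (Module.finrank ℂ 𝔟 - Module.finrank ℂ ↥(𝔟 ⊓ K.tangent)))
              (Module.finrank ℂ 𝔟 - Module.finrank ℂ ↥(𝔟 ⊓ K.tangent)) : ℝ) *
            (orbitCard L κM K v S : ℝ) * (D : ℝ) ^ Module.finrank ℂ K.tangent ≤
            c * (D : ℝ) ^ Fintype.card (β ⊕ (γ ⊕ δ)))
    {𝔟 : Submodule ℂ (β ⊕ (γ ⊕ δ) → ℂ)} (hrat : IsKRational Kbar 𝔟) (h𝔟 : 𝔟 ≠ ⊤)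
    (hss : Semistable κM 𝔟) {w : β ⊕ (γ ⊕ δ) → ℂ} (hw𝔟 : w ∈ 𝔟) (hw : w ∈ AlgTors L κM)
    (hpar : ∀ B : BakerData β γ δ, B.L = L → B.κM = κM → B.v = w → B.dd = Module.finrank ℂ 𝔟 →
      Submodule.span ℂ (Set.range B.xs) = 𝔟 → ∀ c : ℝ, 0 < c → AdmissibleParams B (Module.finrank ℂ 𝔟) c) :
    ∃ K : SubgroupDataC β γ δ κM, K.tangent ≠ ⊤ ∧
      Module.finrank ℂ 𝔟 * (Fintype.card (β ⊕ (γ ⊕ δ)) - Module.finrank ℂ K.tangent) =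
        (Module.finrank ℂ 𝔟 - Module.finrank ℂ ↥(𝔟 ⊓ K.tangent)) * Fintype.card (β ⊕ (γ ⊕ δ)) ∧
      ∃ r : ℕ, 0 < r ∧ (r : ℂ) • w ∈ preimageSubgroup L κM K := by
  classical
  set n := Fintype.card (β ⊕ (γ ⊕ δ)) with hn
  -- `n ≥ 1` and `dim 𝔟 < n`
  have h𝔟lt : Module.finrank ℂ 𝔟 < n := by
    have := Submodule.finrank_lt h𝔟; simpa [hn] using this
  -- the degenerate case `𝔟 = 0`: `w = 0`, take `K = 0`
  by_cases h0 : Module.finrank ℂ 𝔟 = 0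
  · have h𝔟0 : 𝔟 = ⊥ := Submodule.finrank_eq_zero.mp h0
    have hw0 : w = 0 := by rw [h𝔟0, Submodule.mem_bot] at hw𝔟; exact hw𝔟
    refine ⟨SubgroupDataC.zero κM, ?_, ?_, 1, one_pos, ?_⟩
    · rw [SubgroupDataC.tangent_zero]
      intro h
      have : Module.finrank ℂ (⊥ : Submodule ℂ (β ⊕ (γ ⊕ δ) → ℂ)) = Module.finrank ℂ (⊤ : Submodule ℂ (β ⊕ (γ ⊕ δ) → ℂ)) := by
        rw [h]
      rw [finrank_bot, finrank_top, Module.finrank_fintype_fun_eq_card, ← hn] at this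
      omega
    · rw [h0]; simp
    · rw [hw0, smul_zero]; exact AddSubgroup.zero_mem _
  have h𝔟pos : 0 < Module.finrank ℂ 𝔟 := Nat.pos_of_ne_zero h0
  -- the Baker datum and Philippon's constant
  obtain ⟨B, hBL, hBκ, hBv, hBdd, hBspan⟩ := exists_bakerData L h₂ h₃ κM hrat hw
  obtain ⟨c, hc, hZ⟩ := hZ
  obtain ⟨D', T, S₀, S, T'', R, hT, hD', hS, hpq, hR0, hR, hnum, hineq⟩ := hpar B hBL hBκ hBv hBdd hBspan c hc
  -- run the engine
  have hv : B.v ∈ B.bSpan := by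
    show B.v ∈ Submodule.span ℂ (Set.range B.xs)
    rw [hBspan, hBv]; exact hw𝔟
  obtain ⟨P, hP, hne, hvan⟩ := B.engine₂ hv D' T S₀ (n * S) (n * T'' + 1) R hT hpq hR0 (by exact_mod_cast hR) hnum
  -- Philippon's zero estimate
  have hD1 : 1 ≤ n * D' := Nat.one_le_iff_ne_zero.mpr (Nat.mul_ne_zero (by omega) (by omega))
  have hvan' : ∀ s : ℕ, s ≤ n * S → VanishesAlong 𝔟 (thetaEval L κM P) ((s : ℂ) • w) (n * T'' + 1) := by
    intro s hs
    have := hvan s hs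
    rwa [show B.bSpan = 𝔟 from hBspan, hBL, hBκ, hBv] at this
  have hne' : ∃ w', thetaEval L κM P w' ≠ 0 := by rwa [hBL, hBκ] at hne
  obtain ⟨K, ⟨w₀, hw₀⟩, hK⟩ := hZ 𝔟 w P (n * D') S T'' h𝔟pos hD1 hS hP hne' hvan'
  -- `K ≠ M_κ`
  have hKtop : K.tangent ≠ ⊤ := by
    intro htop
    obtain ⟨w', hw'⟩ := hne'
    apply hw'
    have := hw₀ (w' - w₀) (by rw [htop]; trivial)
    simpa using this
  have hm : Module.finrank ℂ K.tangent < n := by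
    have := Submodule.finrank_lt hKtop; simpa [hn] using this
  -- the index inequality
  have hidx := hss.index_le κM hrat K hKtop
  set e := Module.finrank ℂ 𝔟 - Module.finrank ℂ ↥(𝔟 ⊓ K.tangent) with he
  set m := Module.finrank ℂ K.tangent with hm'
  obtain ⟨hfull, hstrict⟩ := hineq e m hm hidx
  -- orbit dichotomy
  have horb_le := orbitCard_le L κM K w S
  have hD0 : (0 : ℝ) < ((n * D' : ℕ) : ℝ) := by exact_mod_cast hD1
  by_cases horb : orbitCard L κM K w S = S + 1
  · -- full orbit: numerics contradict Philippon
    exfalso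
    rw [horb] at hK
    rw [← hn] at hfull
    push_cast at hK hfull
    linarith
  · -- small orbit: a multiple of `w` meets `Lie K + ker`; then `K` must be borderline
    obtain ⟨r, hr, -, hrmem⟩ := orbitCard_lt_imp L κM K w S (lt_of_le_of_ne horb_le horb)
    refine ⟨K, hKtop, ?_, r, hr, hrmem⟩
    by_contra hneq
    have hlt : Module.finrank ℂ 𝔟 * (n - m) < e * n := lt_of_le_of_ne hidx hneq
    have h1 := hstrict hlt
    have horb1 : (1 : ℝ) ≤ orbitCard L κM K w S := by exact_mod_cast one_le_orbitCard L κM K w S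
    have h2 : (Nat.choose (T'' + e) e : ℝ) * ((n * D' : ℕ) : ℝ) ^ m ≤
        (Nat.choose (T'' + e) e : ℝ) * (orbitCard L κM K w S : ℝ) * ((n * D' : ℕ) : ℝ) ^ m := by
      have hch : (0 : ℝ) ≤ (Nat.choose (T'' + e) e : ℝ) := Nat.cast_nonneg _
      have hpow : (0 : ℝ) ≤ ((n * D' : ℕ) : ℝ) ^ m := by positivity
      rw [show (Nat.choose (T'' + e) e : ℝ) * ((n * D' : ℕ) : ℝ) ^ m =
        (Nat.choose (T'' + e) e : ℝ) * 1 * ((n * D' : ℕ) : ℝ) ^ m from by ring]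
      exact mul_le_mul_of_nonneg_right (mul_le_mul_of_nonneg_left horb1 hch) hpow
    rw [← hn] at h1
    push_cast at hK h1 h2
    linarith

/-- **The dichotomy, unconditionally in the parameters, from the zero estimate for this `M_κ`**:
`NumCondFamily.dichotomy'` per lattice — `dichotomy_of_zeroEstimateAt` with `hpar` discharged by
`BakerData.admissibleParams_of_lt`. [cite: BakerWustholz2007, Thm 6.15, §6.8 (p. 119)] [cite: Philippon1986, Thm 2.1] -/
theorem dichotomy'_of_zeroEstimateAt (L : PeriodPair) (h₂ : IsAlgebraic ℚ L.g₂)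
    (h₃ : IsAlgebraic ℚ L.g₃) (κM : δ → γ → Kbar)
    (hZ : ∃ c : ℝ, 0 < c ∧ ∀ (𝔟 : Submodule ℂ (β ⊕ (γ ⊕ δ) → ℂ)) (v : β ⊕ (γ ⊕ δ) → ℂ)
        (P : MvPolynomial (Option β × ThetaIdx γ δ) ℂ) (D S T : ℕ),
        0 < Module.finrank ℂ 𝔟 → 1 ≤ D → 1 ≤ S → P.IsHomogeneous D → (∃ w, thetaEval L κM P w ≠ 0) →
        (∀ s : ℕ, s ≤ Fintype.card (β ⊕ (γ ⊕ δ)) * S →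
          VanishesAlong 𝔟 (thetaEval L κM P) ((s : ℂ) • v) (Fintype.card (β ⊕ (γ ⊕ δ)) * T + 1)) →
        ∃ K : SubgroupDataC β γ δ κM,
          (∃ w₀, ∀ w ∈ K.tangent, thetaEval L κM P (w₀ + w) = 0) ∧
          (Nat.choose (T + (Module.finrank ℂ 𝔟 - Module.finrank ℂ ↥(𝔟 ⊓ K.tangent)))
              (Module.finrank ℂ 𝔟 - Module.finrank ℂ ↥(𝔟 ⊓ K.tangent)) : ℝ) *
            (orbitCard L κM K v S : ℝ) * (D : ℝ) ^ Module.finrank ℂ K.tangent ≤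
            c * (D : ℝ) ^ Fintype.card (β ⊕ (γ ⊕ δ)))
    {𝔟 : Submodule ℂ (β ⊕ (γ ⊕ δ) → ℂ)} (hrat : IsKRational Kbar 𝔟) (h𝔟 : 𝔟 ≠ ⊤)
    (hss : Semistable κM 𝔟) {w : β ⊕ (γ ⊕ δ) → ℂ} (hw𝔟 : w ∈ 𝔟) (hw : w ∈ AlgTors L κM) :
    ∃ K : SubgroupDataC β γ δ κM, K.tangent ≠ ⊤ ∧
      Module.finrank ℂ 𝔟 * (Fintype.card (β ⊕ (γ ⊕ δ)) - Module.finrank ℂ K.tangent) =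
        (Module.finrank ℂ 𝔟 - Module.finrank ℂ ↥(𝔟 ⊓ K.tangent)) * Fintype.card (β ⊕ (γ ⊕ δ)) ∧
      ∃ r : ℕ, 0 < r ∧ (r : ℂ) • w ∈ preimageSubgroup L κM K := by
  refine dichotomy_of_zeroEstimateAt L h₂ h₃ κM hZ hrat h𝔟 hss hw𝔟 hw ?_
  intro B _ _ _ hBdd _ c hc
  have hlt : Module.finrank ℂ 𝔟 < Fintype.card (β ⊕ (γ ⊕ δ)) := by
    have h := Submodule.finrank_lt h𝔟
    simpa [Module.finrank_fintype_fun_eq_card] using h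
  have hdd : B.dd < Fintype.card (β ⊕ (γ ⊕ δ)) := hBdd ▸ hlt
  exact hBdd ▸ B.admissibleParams_of_lt hdd hc

/-- **The dichotomy theorem of the torsion case, from the zero estimate for this `M_κ`**:
`TorsionDichotomy.torsionDichotomy` per lattice (same proof). Let `Λ` have algebraic invariants,
`𝔟 ⊊ Lie M_κ` `ℚ̄`-rational and semistable, `w ∈ 𝔟` with `exp(w)` algebraic with torsion abelian
part, `P₀·w ∈ ker(exp)` for some `P₀ ≥ 1` but `w ∉ ker(exp)`. Then there is a connected algebraic
subgroup datum `K` over `ℂ` with `Lie K ≠ Lie M_κ`, `Lie K ≠ 0`, borderline for `𝔟`.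
[cite: BakerWustholz2007, §6.8 (pp. 117–119)] [cite: Philippon1986, Thm 2.1] -/
theorem torsionDichotomy_of_zeroEstimateAt (L : PeriodPair) (h₂ : IsAlgebraic ℚ L.g₂)
    (h₃ : IsAlgebraic ℚ L.g₃) (κM : δ → γ → Kbar)
    (hZ : ∃ c : ℝ, 0 < c ∧ ∀ (𝔟 : Submodule ℂ (β ⊕ (γ ⊕ δ) → ℂ)) (v : β ⊕ (γ ⊕ δ) → ℂ)
        (P : MvPolynomial (Option β × ThetaIdx γ δ) ℂ) (D S T : ℕ),
        0 < Module.finrank ℂ 𝔟 → 1 ≤ D → 1 ≤ S → P.IsHomogeneous D → (∃ w, thetaEval L κM P w ≠ 0) →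
        (∀ s : ℕ, s ≤ Fintype.card (β ⊕ (γ ⊕ δ)) * S →
          VanishesAlong 𝔟 (thetaEval L κM P) ((s : ℂ) • v) (Fintype.card (β ⊕ (γ ⊕ δ)) * T + 1)) →
        ∃ K : SubgroupDataC β γ δ κM,
          (∃ w₀, ∀ w ∈ K.tangent, thetaEval L κM P (w₀ + w) = 0) ∧
          (Nat.choose (T + (Module.finrank ℂ 𝔟 - Module.finrank ℂ ↥(𝔟 ⊓ K.tangent)))
              (Module.finrank ℂ 𝔟 - Module.finrank ℂ ↥(𝔟 ⊓ K.tangent)) : ℝ) *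
            (orbitCard L κM K v S : ℝ) * (D : ℝ) ^ Module.finrank ℂ K.tangent ≤
            c * (D : ℝ) ^ Fintype.card (β ⊕ (γ ⊕ δ)))
    {𝔟 : Submodule ℂ (β ⊕ (γ ⊕ δ) → ℂ)} (hrat : IsKRational Kbar 𝔟) (h𝔟 : 𝔟 ≠ ⊤)
    (hss : Semistable κM 𝔟) {w : β ⊕ (γ ⊕ δ) → ℂ} (hw𝔟 : w ∈ 𝔟) (hw : w ∈ AlgTors L κM)
    {P₀ : ℕ} (hP₀ : 0 < P₀) (hPw : (P₀ : ℂ) • w ∈ ker L κM) (hwker : w ∉ ker L κM) :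
    ∃ K : SubgroupDataC β γ δ κM, K.tangent ≠ ⊤ ∧ K.tangent ≠ ⊥ ∧
      Module.finrank ℂ 𝔟 * (Fintype.card (β ⊕ (γ ⊕ δ)) - Module.finrank ℂ K.tangent) =
        (Module.finrank ℂ 𝔟 - Module.finrank ℂ ↥(𝔟 ⊓ K.tangent)) * Fintype.card (β ⊕ (γ ⊕ δ)) := by
  classical
  set n := Fintype.card (β ⊕ (γ ⊕ δ)) with hn
  set d := Module.finrank ℂ 𝔟 with hd
  -- `0 < d < n`
  have hdlt : d < n := by
    have := Submodule.finrank_lt h𝔟; simpa [hn, hd] using this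
  have hdpos : 0 < d := by
    by_contra h0
    have h0' : d = 0 := by omega
    have h𝔟0 : 𝔟 = ⊥ := Submodule.finrank_eq_zero.mp h0'
    have hw0 : w = 0 := by rw [h𝔟0, Submodule.mem_bot] at hw𝔟; exact hw𝔟
    exact hwker (by rw [hw0]; exact zero_mem_ker L κM)
  have hn1 : 1 ≤ n := by omega
  -- Philippon's constant
  obtain ⟨c, hc, hZ⟩ := hZ
  -- the orbit bound and the threshold for the prime `ℓ`
  obtain ⟨M₀, hM₀⟩ := exists_bound_forall_notMem_ker L κM hP₀ hPw hwker
  set Kc : ℝ := c * ((n * (2 * (4 * n) ^ d * (P₀ - 1 + 1)) : ℕ) : ℝ) ^ n * (n.factorial : ℝ) with hKc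
  obtain ⟨ℓ, hℓge, hℓ⟩ := Nat.exists_infinite_primes (M₀ + ⌈Kc⌉₊ + 1)
  have hℓM₀ : M₀ < ℓ := by omega
  have hℓKc : Kc < ℓ := by
    have h1 := Nat.le_ceil Kc
    have h2 : ((⌈Kc⌉₊ + 1 : ℕ) : ℝ) ≤ ℓ := by exact_mod_cast (show ⌈Kc⌉₊ + 1 ≤ ℓ by omega)
    push_cast at h2; linarith
  have hℓpos : 0 < ℓ := hℓ.pos
  have hℓ0 : (ℓ : ℂ) ≠ 0 := by exact_mod_cast hℓ.ne_zero
  -- the division point `v = w/ℓ`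
  set v : β ⊕ (γ ⊕ δ) → ℂ := (ℓ : ℂ)⁻¹ • w with hv
  have hv𝔟 : v ∈ 𝔟 := Submodule.smul_mem _ _ hw𝔟
  have hvAlg : v ∈ AlgTors L κM := inv_natCast_smul_mem_AlgTors L κM h₂ h₃ hw hℓpos
  have horbit : ∀ r : ℕ, 0 < r → r < ℓ → (r : ℂ) • v ∉ ker L κM := hM₀ ℓ hℓ hℓM₀
  -- the Baker datum at `v`
  obtain ⟨B, hBL, hBκ, hBv, hBdd, hBspan⟩ := exists_bakerData L h₂ h₃ κM hrat hvAlg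
  have hBdd' : B.dd = d := hBdd
  have hddlt : B.dd < Fintype.card (β ⊕ (γ ⊕ δ)) := by rw [hBdd', ← hn]; exact hdlt
  -- the parameters of the torsion engine
  have hspc : c * ((Fintype.card (β ⊕ (γ ⊕ δ)) * (2 * (4 * Fintype.card (β ⊕ (γ ⊕ δ))) ^ B.dd * (P₀ - 1 + 1)) : ℕ) : ℝ) ^
      Fintype.card (β ⊕ (γ ⊕ δ)) * ((Fintype.card (β ⊕ (γ ⊕ δ))).factorial : ℝ) < ℓ := by
    rw [hBdd', ← hn]; exact hℓKc
  obtain ⟨D', T, S₀, S, T'', R, hT, hD', hS, hℓS, hpq, hR0, hR, hnum, hineq⟩ :=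
    B.admissibleParams₃_of_lt hddlt hc (P₀ - 1) hspc
  -- periodicity datum: `(ℓ P₀)·v = P₀·w ∈ ker`
  have hper : ((ℓ * (P₀ - 1 + 1) : ℕ) : ℂ) • B.v ∈ ker B.L B.κM := by
    rw [hBv, hBL, hBκ, hv, smul_smul, show P₀ - 1 + 1 = P₀ by omega]
    have e : ((ℓ * P₀ : ℕ) : ℂ) * (ℓ : ℂ)⁻¹ = (P₀ : ℂ) := by push_cast; field_simp
    rw [e]; exact hPw
  -- run the torsion engine
  have hvspan : B.v ∈ B.bSpan := by
    show B.v ∈ Submodule.span ℂ (Set.range B.xs)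
    rw [hBspan, hBv]; exact hv𝔟
  obtain ⟨P, hP, hne, hvan⟩ := B.engine₃ hvspan ℓ D' T (P₀ - 1) S₀ (n * S) (n * T'' + 1) R hℓpos hT hpq hper hR0
    (by rw [hn]; exact hR) (by rw [hn]; exact hnum)
  -- Philippon's zero estimate
  have hD1 : 1 ≤ n * D' := Nat.one_le_iff_ne_zero.mpr (Nat.mul_ne_zero (by omega) (by omega))
  have hvan' : ∀ s : ℕ, s ≤ n * S → VanishesAlong 𝔟 (thetaEval L κM P) ((s : ℂ) • v) (n * T'' + 1) := by
    intro s hs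
    have := hvan s hs
    rwa [show B.bSpan = 𝔟 from hBspan, hBL, hBκ, hBv] at this
  have hne' : ∃ w', thetaEval L κM P w' ≠ 0 := by rwa [hBL, hBκ] at hne
  have hP' : P.IsHomogeneous (n * D') := by rw [hn]; exact hP
  obtain ⟨K, ⟨w₀, hw₀⟩, hK⟩ := hZ 𝔟 v P (n * D') S T'' (by rw [← hd]; exact hdpos) hD1 hS hP' hne' hvan'
  -- `K ≠ M_κ`
  have hKtop : K.tangent ≠ ⊤ := by
    intro htop
    obtain ⟨w', hw'⟩ := hne'
    apply hw'
    have := hw₀ (w' - w₀) (by rw [htop]; trivial)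
    simpa using this
  have hm : Module.finrank ℂ K.tangent < n := by
    have := Submodule.finrank_lt hKtop; simpa [hn] using this
  -- the index inequality and the numerics
  have hidx := hss.index_le κM hrat K hKtop
  set e := Module.finrank ℂ 𝔟 - Module.finrank ℂ ↥(𝔟 ⊓ K.tangent) with he
  set m := Module.finrank ℂ K.tangent with hm'
  rw [← hn, ← hd] at hidx
  obtain ⟨hfull, hstrict⟩ := hineq e m hm (by rw [hBdd']; exact hidx)
  have hD0 : (0 : ℝ) < ((n * D' : ℕ) : ℝ) := by exact_mod_cast hD1
  have horb1 : (1 : ℝ) ≤ orbitCard L κM K v S := by exact_mod_cast one_le_orbitCard L κM K v S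
  -- orbit dichotomy at the threshold `ℓ`
  by_cases horb : ℓ ≤ orbitCard L κM K v S
  · -- large orbit: the numerics contradict Philippon
    exfalso
    have horb' : (ℓ : ℝ) ≤ orbitCard L κM K v S := by exact_mod_cast horb
    have h2 : (Nat.choose (T'' + e) e : ℝ) * (ℓ : ℝ) * ((n * D' : ℕ) : ℝ) ^ m ≤
        (Nat.choose (T'' + e) e : ℝ) * (orbitCard L κM K v S : ℝ) * ((n * D' : ℕ) : ℝ) ^ m := by
      have hch : (0 : ℝ) ≤ (Nat.choose (T'' + e) e : ℝ) := Nat.cast_nonneg _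
      have hpow : (0 : ℝ) ≤ ((n * D' : ℕ) : ℝ) ^ m := by positivity
      exact mul_le_mul_of_nonneg_right (mul_le_mul_of_nonneg_left horb' hch) hpow
    rw [← hn] at hfull
    push_cast at hK hfull h2
    linarith
  · -- small orbit: a multiple `r·v`, `0 < r < ℓ`, lies in `Lie K + ker`
    have hsmall : ∃ r : ℕ, 0 < r ∧ r < ℓ ∧ (r : ℂ) • v ∈ preimageSubgroup L κM K := by
      by_contra hno
      push Not at hno
      exact horb (le_orbitCard L κM K v hℓS fun r hr hrℓ => hno r hr hrℓ)
    obtain ⟨r, hr, hrℓ, hrmem⟩ := hsmall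
    -- `K ≠ 0`: otherwise `r·v` would be a period
    have hKbot : K.tangent ≠ ⊥ := by
      intro hbot
      exact horbit r hr hrℓ ((mem_preimageSubgroup_of_tangent_eq_bot L κM hbot).mp hrmem)
    refine ⟨K, hKtop, hKbot, ?_⟩
    -- `K` must be borderline
    change d * (n - m) = e * n
    by_contra hneq
    have hlt : d * (n - m) < e * n := lt_of_le_of_ne hidx hneq
    have h1 := hstrict (by rw [hBdd']; exact hlt)
    have h2 : (Nat.choose (T'' + e) e : ℝ) * ((n * D' : ℕ) : ℝ) ^ m ≤
        (Nat.choose (T'' + e) e : ℝ) * (orbitCard L κM K v S : ℝ) * ((n * D' : ℕ) : ℝ) ^ m := by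
      have hch : (0 : ℝ) ≤ (Nat.choose (T'' + e) e : ℝ) := Nat.cast_nonneg _
      have hpow : (0 : ℝ) ≤ ((n * D' : ℕ) : ℝ) ^ m := by positivity
      rw [show (Nat.choose (T'' + e) e : ℝ) * ((n * D' : ℕ) : ℝ) ^ m =
        (Nat.choose (T'' + e) e : ℝ) * 1 * ((n * D' : ℕ) : ℝ) ^ m from by ring]
      exact mul_le_mul_of_nonneg_right (mul_le_mul_of_nonneg_left horb1 hch) hpow
    rw [← hn] at h1
    push_cast at hK h1 h2
    linarith

/-- **The Semistability Theorem for a STABLE `𝔟`, from the zero estimate for this `M_κ`**: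
`StableClosing.mem_ker_of_stable` per lattice (same proof: one run of Baker's method, then the
torsion run). Let `Λ` have algebraic invariants, `𝔟 ⊊ Lie M_κ` `ℚ̄`-rational and semistable with
no borderline `0 ≠ K ≠ M_κ` (`ℚ̄`-data); then every `w ∈ 𝔟` with `exp(w)` algebraic with torsion
abelian part lies in `ker(exp)`. [cite: BakerWustholz2007, Thm. 6.15, §6.8 (pp. 116–119)] [cite: Philippon1986, Thm 2.1] -/
theorem mem_ker_of_stable_of_zeroEstimateAt (L : PeriodPair) (h₂ : IsAlgebraic ℚ L.g₂)
    (h₃ : IsAlgebraic ℚ L.g₃) (κM : δ → γ → Kbar)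
    (hZ : ∃ c : ℝ, 0 < c ∧ ∀ (𝔟 : Submodule ℂ (β ⊕ (γ ⊕ δ) → ℂ)) (v : β ⊕ (γ ⊕ δ) → ℂ)
        (P : MvPolynomial (Option β × ThetaIdx γ δ) ℂ) (D S T : ℕ),
        0 < Module.finrank ℂ 𝔟 → 1 ≤ D → 1 ≤ S → P.IsHomogeneous D → (∃ w, thetaEval L κM P w ≠ 0) →
        (∀ s : ℕ, s ≤ Fintype.card (β ⊕ (γ ⊕ δ)) * S →
          VanishesAlong 𝔟 (thetaEval L κM P) ((s : ℂ) • v) (Fintype.card (β ⊕ (γ ⊕ δ)) * T + 1)) →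
        ∃ K : SubgroupDataC β γ δ κM,
          (∃ w₀, ∀ w ∈ K.tangent, thetaEval L κM P (w₀ + w) = 0) ∧
          (Nat.choose (T + (Module.finrank ℂ 𝔟 - Module.finrank ℂ ↥(𝔟 ⊓ K.tangent)))
              (Module.finrank ℂ 𝔟 - Module.finrank ℂ ↥(𝔟 ⊓ K.tangent)) : ℝ) *
            (orbitCard L κM K v S : ℝ) * (D : ℝ) ^ Module.finrank ℂ K.tangent ≤
            c * (D : ℝ) ^ Fintype.card (β ⊕ (γ ⊕ δ)))
    {𝔟 : Submodule ℂ (β ⊕ (γ ⊕ δ) → ℂ)} (hrat : IsKRational Kbar 𝔟) (h𝔟 : 𝔟 ≠ ⊤)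
    (hss : Semistable κM 𝔟)
    (hst : ∀ D : SubgroupData β γ δ κM, D.tangent ≠ ⊤ → D.tangent ≠ ⊥ →
      Module.finrank ℂ 𝔟 * (Fintype.card (β ⊕ (γ ⊕ δ)) - Module.finrank ℂ D.tangent) ≠
        (Module.finrank ℂ 𝔟 - Module.finrank ℂ ↥(𝔟 ⊓ D.tangent)) * Fintype.card (β ⊕ (γ ⊕ δ)))
    {w : β ⊕ (γ ⊕ δ) → ℂ} (hw𝔟 : w ∈ 𝔟) (hw : w ∈ AlgTors L κM) : w ∈ ker L κM := by
  by_contra hwker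
  -- the first run of Baker's method
  obtain ⟨K, hKtop, hbord, r, hr, hrmem⟩ := dichotomy'_of_zeroEstimateAt L h₂ h₃ κM hZ hrat h𝔟 hss hw𝔟 hw
  -- by stability, `Lie K = 0`
  have hKbot : K.tangent = ⊥ := by
    by_contra hKbot
    obtain ⟨D, hDtop, hDbot, hDbord⟩ := hss.exists_borderline_rational κM hrat K hKtop hKbot hbord
    exact hst D hDtop hDbot hDbord
  -- so `r·w` is a period: the torsion case
  have hrw : (r : ℂ) • w ∈ ker L κM := (mem_preimageSubgroup_of_tangent_eq_bot L κM hKbot).mp hrmem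
  obtain ⟨K₂, hK₂top, hK₂bot, hK₂bord⟩ :=
    torsionDichotomy_of_zeroEstimateAt L h₂ h₃ κM hZ hrat h𝔟 hss hw𝔟 hw hr hrw hwker
  obtain ⟨D, hDtop, hDbot, hDbord⟩ := hss.exists_borderline_rational κM hrat K₂ hK₂top hK₂bot hK₂bord
  exact hst D hDtop hDbot hDbord

end Closing

/-! ### The induction over borderline quotients and subgroups, at most one elliptic factor -/

/-- **The Semistability Theorem for the `M_κ` over one lattice with at most one elliptic factor
(torsion abelian part), by strong induction on `n = dim M_κ`**, from Philippon's zero estimate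
for all the `M_κ` over `L` with `|γ| ≤ 1` (hypothesis `hZ`; complex multiplication allowed): for
`Λ` with algebraic invariants, every standard model `M_κ` over `Λ` of dimension `n` with at most
one elliptic coordinate, every semistable proper `ℚ̄`-rational `𝔟 ⊆ Lie M_κ` and every `w ∈ 𝔟`
with `exp(w)` algebraic with torsion abelian part, `w ∈ ker(exp)`. The proof of
`SemistabilityInduction.mem_ker_of_semistable_card`, the quotient `M_κ/K₀` and the subgroup `K₀`
of a borderline `K₀` having again at most one elliptic coordinate (`QuotData.nC_le_card`,
`SubData.nC_le_card`). [cite: BakerWustholz2007, Thm. 6.15, §6.8 (p. 115: induction over G^* and B ∩ ker π; pp. 116–119)] [cite: Philippon1986, Thm 2.1] -/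
theorem mem_ker_of_semistable_card_oneFactor (L : PeriodPair) (h₂ : IsAlgebraic ℚ L.g₂)
    (h₃ : IsAlgebraic ℚ L.g₃)
    (hZ : ∀ (β γ δ : Type) [Fintype β] [Fintype γ] [Fintype δ] [DecidableEq γ] (κM : δ → γ → Kbar),
      Fintype.card γ ≤ 1 →
      ∃ c : ℝ, 0 < c ∧ ∀ (𝔟 : Submodule ℂ (β ⊕ (γ ⊕ δ) → ℂ)) (v : β ⊕ (γ ⊕ δ) → ℂ)
        (P : MvPolynomial (Option β × ThetaIdx γ δ) ℂ) (D S T : ℕ),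
        0 < Module.finrank ℂ 𝔟 → 1 ≤ D → 1 ≤ S → P.IsHomogeneous D → (∃ w, thetaEval L κM P w ≠ 0) →
        (∀ s : ℕ, s ≤ Fintype.card (β ⊕ (γ ⊕ δ)) * S →
          VanishesAlong 𝔟 (thetaEval L κM P) ((s : ℂ) • v) (Fintype.card (β ⊕ (γ ⊕ δ)) * T + 1)) →
        ∃ K : SubgroupDataC β γ δ κM,
          (∃ w₀, ∀ w ∈ K.tangent, thetaEval L κM P (w₀ + w) = 0) ∧
          (Nat.choose (T + (Module.finrank ℂ 𝔟 - Module.finrank ℂ ↥(𝔟 ⊓ K.tangent)))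
              (Module.finrank ℂ 𝔟 - Module.finrank ℂ ↥(𝔟 ⊓ K.tangent)) : ℝ) *
            (orbitCard L κM K v S : ℝ) * (D : ℝ) ^ Module.finrank ℂ K.tangent ≤
            c * (D : ℝ) ^ Fintype.card (β ⊕ (γ ⊕ δ)))
    (n : ℕ) :
    ∀ (β γ δ : Type) [Fintype β] [Fintype γ] [Fintype δ] (κM : δ → γ → Kbar)
      (𝔟 : Submodule ℂ (β ⊕ (γ ⊕ δ) → ℂ)), Fintype.card (β ⊕ (γ ⊕ δ)) = n → Fintype.card γ ≤ 1 →
      IsKRational Kbar 𝔟 → 𝔟 ≠ ⊤ → Semistable κM 𝔟 →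
      ∀ w ∈ 𝔟, w ∈ AlgTors L κM → w ∈ ker L κM := by
  induction n using Nat.strong_induction_on with
  | _ n ih =>
  intro β γ δ _ _ _ κM 𝔟 hn hγ hrat h𝔟 hss w hw𝔟 hw
  classical
  by_cases hbord : ∃ D : SubgroupData β γ δ κM, D.tangent ≠ ⊤ ∧ D.tangent ≠ ⊥ ∧
      finrank ℂ 𝔟 * (Fintype.card (β ⊕ (γ ⊕ δ)) - finrank ℂ D.tangent) =
        (finrank ℂ 𝔟 - finrank ℂ ↥(𝔟 ⊓ D.tangent)) * Fintype.card (β ⊕ (γ ⊕ δ))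
  · -- a borderline `0 ≠ K₀ ≠ M_κ`: induct over `M_κ/K₀` and `K₀`
    obtain ⟨D₀, hD₀top, hD₀bot, hD₀bord⟩ := hbord
    have hk₀pos : 0 < finrank ℂ ↥D₀.tangent := by
      rw [Nat.pos_iff_ne_zero, Ne, Submodule.finrank_eq_zero]; exact hD₀bot
    have hk₀lt : finrank ℂ ↥D₀.tangent < n := by
      have := Submodule.finrank_lt hD₀top; simpa [hn] using this
    -- Step 1: `w ∈ Lie K₀`, through the quotient `M_κ/K₀` at all division points `w/m`
    obtain ⟨Q⟩ := nonempty_quotData D₀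
    obtain ⟨hrat', htop', hss'⟩ := Q.transport hrat h𝔟 hss hD₀top hD₀bord
    have hcard' : Fintype.card Q.σ' < n := by
      have := Q.card_eq; rw [hn] at this; omega
    have hγ' : Fintype.card (Fin Q.nC) ≤ 1 := by
      rw [Fintype.card_fin]; exact le_trans Q.nC_le_card hγ
    have hwD₀ : w ∈ D₀.tangent := by
      refine D₀.mem_tangent_of_forall_exists (L := L) w fun m hm => ?_
      have hwm : (m : ℂ)⁻¹ • w ∈ AlgTors L κM := inv_natCast_smul_mem_AlgTors L κM h₂ h₃ hw hm
      have hwm𝔟 : (m : ℂ)⁻¹ • w ∈ 𝔟 := Submodule.smul_mem _ _ hw𝔟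
      have hΦ : Q.Φ ((m : ℂ)⁻¹ • w) ∈ ker L Q.κM' :=
        ih _ hcard' (Fin Q.nA) (Fin Q.nC) (Fin Q.nΞ) Q.κM' (𝔟.map Q.Φ) rfl hγ' hrat' htop' hss' _
          (Submodule.mem_map_of_mem hwm𝔟) (Q.Φ_mem_AlgTors h₂ h₃ hwm)
      obtain ⟨k, hk, hh⟩ := Q.exists_ker_of_Φ_mem_ker hΦ
      refine ⟨k, hk, (m : ℂ)⁻¹ • w - k, hh, ?_⟩
      have hm0 : (m : ℂ) ≠ 0 := by exact_mod_cast hm.ne'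
      rw [add_sub_cancel, smul_smul, mul_inv_cancel₀ hm0, one_smul]
    -- Step 2: transport to the subgroup `K₀ = M_κ''`
    obtain ⟨S⟩ := nonempty_subData D₀
    obtain ⟨hratS, htopS, hssS⟩ := S.transport hrat h𝔟 hss hD₀top hD₀bot hD₀bord
    have hcardS : Fintype.card S.σ' < n := by rw [S.card_eq]; exact hk₀lt
    have hγS : Fintype.card (Fin S.nC) ≤ 1 := by
      rw [Fintype.card_fin]; exact le_trans S.nC_le_card hγ
    obtain ⟨w', hw'⟩ := S.exists_eq_ι hwD₀
    have hw'𝔟 : w' ∈ 𝔟.comap S.ι := by show S.ι w' ∈ 𝔟; rw [hw']; exact hw𝔟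
    have hw'alg : w' ∈ AlgTors L S.κS := S.mem_AlgTors_of_ι h₂ h₃ (by rw [hw']; exact hw)
    have hker' := ih _ hcardS (Fin S.nA) (Fin S.nC) (Fin S.nΞ) S.κS (𝔟.comap S.ι) rfl hγS hratS htopS hssS
      w' hw'𝔟 hw'alg
    rw [← hw']
    exact S.ι_mem_ker hker'
  · -- `𝔟` is stable
    push Not at hbord
    exact mem_ker_of_stable_of_zeroEstimateAt L h₂ h₃ κM (hZ β γ δ κM hγ) hrat h𝔟 hss
      (fun D h1 h2 => hbord D h1 h2) hw𝔟 hw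

/-- **The hyperplane statement for the `M_κ` over one lattice with at most one elliptic factor,
at points with torsion abelian part, from Philippon's zero estimate over that lattice** (CM
allowed): for a `ℚ̄`-rational hyperplane `W` of `Lie M_κ` (`|γ| ≤ 1`) containing no non-zero
algebraic Lie subalgebra and `w ∈ W` with `exp(w)` algebraic with torsion abelian part,
`w ∈ ker(exp)`. Such a `W` is proper (`Std.ne_top_of_hyperplane`) and semistable
(`Std.semistable_of_hyperplane`): a case of `mem_ker_of_semistable_card_oneFactor`. This is the
per-lattice, one-factor form of `SemistabilityInduction.analyticSubgroupTheorem_std_tors_of_philippon`.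
[cite: BakerWustholz2007, Thm. 6.15, Thm. 6.1, §6.7] [cite: Philippon1986, Thm 2.1] -/
theorem hyperplane_tors_oneFactor_of_zeroEstimateAt (L : PeriodPair) (h₂ : IsAlgebraic ℚ L.g₂)
    (h₃ : IsAlgebraic ℚ L.g₃)
    (hZ : ∀ (β γ δ : Type) [Fintype β] [Fintype γ] [Fintype δ] [DecidableEq γ] (κM : δ → γ → Kbar),
      Fintype.card γ ≤ 1 →
      ∃ c : ℝ, 0 < c ∧ ∀ (𝔟 : Submodule ℂ (β ⊕ (γ ⊕ δ) → ℂ)) (v : β ⊕ (γ ⊕ δ) → ℂ)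
        (P : MvPolynomial (Option β × ThetaIdx γ δ) ℂ) (D S T : ℕ),
        0 < Module.finrank ℂ 𝔟 → 1 ≤ D → 1 ≤ S → P.IsHomogeneous D → (∃ w, thetaEval L κM P w ≠ 0) →
        (∀ s : ℕ, s ≤ Fintype.card (β ⊕ (γ ⊕ δ)) * S →
          VanishesAlong 𝔟 (thetaEval L κM P) ((s : ℂ) • v) (Fintype.card (β ⊕ (γ ⊕ δ)) * T + 1)) →
        ∃ K : SubgroupDataC β γ δ κM,
          (∃ w₀, ∀ w ∈ K.tangent, thetaEval L κM P (w₀ + w) = 0) ∧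
          (Nat.choose (T + (Module.finrank ℂ 𝔟 - Module.finrank ℂ ↥(𝔟 ⊓ K.tangent)))
              (Module.finrank ℂ 𝔟 - Module.finrank ℂ ↥(𝔟 ⊓ K.tangent)) : ℝ) *
            (orbitCard L κM K v S : ℝ) * (D : ℝ) ^ Module.finrank ℂ K.tangent ≤
            c * (D : ℝ) ^ Fintype.card (β ⊕ (γ ⊕ δ))) :
    ∀ (β γ δ : Type) [Fintype β] [Fintype γ] [Fintype δ] (κM : δ → γ → Kbar),
      Fintype.card γ ≤ 1 →
      ∀ (W : Submodule ℂ (β ⊕ (γ ⊕ δ) → ℂ)), IsKRational Kbar W →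
        finrank ℂ W + 1 = Fintype.card (β ⊕ (γ ⊕ δ)) →
        (∀ 𝔨 ∈ algLie κM, 𝔨 ≤ W → 𝔨 = ⊥) →
        ∀ w ∈ W, w ∈ AlgTors L κM → w ∈ ker L κM :=
  fun β γ δ _ _ _ κM hγ W hWrat hWdim hno w hwW hwAlg =>
    mem_ker_of_semistable_card_oneFactor L h₂ h₃ hZ _ β γ δ κM W rfl hγ hWrat
      (ne_top_of_hyperplane hWdim) (semistable_of_hyperplane κM hWdim hno) w hwW hwAlg

end Std

/-! ### Transport to the quotients of `G = 𝔾ₐ × 𝔾ₘ^ι × (E♮)^κ`, `|κ| ≤ 1` -/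

section Transport

variable {ι κ : Type} [Fintype ι] [Fintype κ]

/-- **A quotient `G/H = M_κ'` of `G = 𝔾ₐ × 𝔾ₘ^ι × (E♮)^κ` has at most `|κ|` elliptic
coordinates** (`nC ≤ |κ|`, unimodularity of the `c⁽ᵇ⁾`). [folklore] -/
theorem QuotData.nC_le_card {D₀ : SubgroupData ι κ} (Q : QuotData D₀) : Q.nC ≤ Fintype.card κ :=
  Std.fin_le_card_of_unimod Q.cv Q.cv_unimod

/-- **Transport at points with torsion abelian part (hyperplane form), one lattice, at most one
elliptic factor.** For a lattice `L` with algebraic invariants (CM allowed) and `|κ| ≤ 1`, the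
hyperplane statement for all the `M_κ'` over `L` with at most one elliptic coordinate at points
with torsion abelian part (hypothesis `hstd`, supplied by
`Std.hyperplane_tors_oneFactor_of_zeroEstimateAt`) implies the hyperplane theorem for the
quotients `G/H` of `G = 𝔾ₐ × 𝔾ₘ^ι × (E♮)^κ` at points with torsion abelian part,
`(presTors L ι κ h₂ h₃).HyperplaneTheorem`. The proof of
`SemistableTorsion.GaGmE.hyperplaneTheorem_presTors_of_std_tors` verbatim, the quotient `G/H`
having `nC ≤ |κ| ≤ 1` elliptic coordinates (`QuotData.nC_le_card`).
[cite: BakerWustholz2007, §6.8 (p. 115: passage to the quotient `G → G^*`)] -/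
theorem hyperplaneTheorem_presTors_oneFactor (L : PeriodPair) (h₂ : IsAlgebraic ℚ L.g₂)
    (h₃ : IsAlgebraic ℚ L.g₃) (hκ : Fintype.card κ ≤ 1)
    (hstd : ∀ (β γ δ : Type) [Fintype β] [Fintype γ] [Fintype δ] (κM : δ → γ → Kbar),
        Fintype.card γ ≤ 1 →
        ∀ (W : Submodule ℂ (β ⊕ (γ ⊕ δ) → ℂ)), LiePresentation.IsKRational Kbar W →
        finrank ℂ W + 1 = Fintype.card (β ⊕ (γ ⊕ δ)) →
        (∀ 𝔨 ∈ Std.algLie κM, 𝔨 ≤ W → 𝔨 = ⊥) →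
        ∀ w ∈ W, w ∈ Std.AlgTors L κM → w ∈ Std.ker L κM) :
    (presTors L ι κ h₂ h₃).HyperplaneTheorem := by
  refine ⟨?_⟩
  rintro _ ⟨D₀, rfl⟩ W hWrat h𝔥W hWdim hmax w hwW hwAlg
  classical
  obtain ⟨Q⟩ := nonempty_quotData D₀
  set W' : Submodule ℂ (Q.σ' → ℂ) := W.map Q.Φ with hW'
  have hcomapW : W'.comap Q.Φ = W := Q.comap_map h𝔥W
  -- (T1) rationality
  have h1 : LiePresentation.IsKRational Kbar W' := Q.isKRational_map hWrat
  -- (T2) `Φ(W)` is a hyperplane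
  set h : ℕ := finrank ℂ ↥D₀.tangent
  have hdimW : finrank ℂ W = finrank ℂ W' + h := by rw [← hcomapW]; exact Q.finrank_comap W'
  have hcard : Fintype.card (Unit ⊕ (ι ⊕ (κ ⊕ κ))) = Fintype.card Q.σ' + h := by
    have e1 : finrank ℂ ↥((⊤ : Submodule ℂ (Q.σ' → ℂ)).comap Q.Φ) =
        finrank ℂ (⊤ : Submodule ℂ (Q.σ' → ℂ)) + h := Q.finrank_comap ⊤
    rw [Submodule.comap_top, finrank_top, finrank_top, Module.finrank_fintype_fun_eq_card,
      Module.finrank_fintype_fun_eq_card] at e1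
    exact e1
  have h2 : finrank ℂ W' + 1 = Fintype.card Q.σ' := by
    change finrank ℂ ↥W + 1 = Fintype.card (Unit ⊕ (ι ⊕ (κ ⊕ κ))) at hWdim
    omega
  -- (T3) no non-zero algebraic Lie subalgebra inside `Φ(W)`
  have h3 : ∀ 𝔨' ∈ Std.algLie Q.κM, 𝔨' ≤ W' → 𝔨' = ⊥ := by
    rintro _ ⟨D', rfl⟩ hle
    have hpullW : (Q.pull D').tangent ≤ W := by
      rw [← Q.comap_tangent, ← hcomapW]
      exact Submodule.comap_mono hle
    have heq : (Q.pull D').tangent = D₀.tangent :=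
      hmax (Q.pull D').tangent ⟨Q.pull D', rfl⟩ (Q.tangent_le_pull D') hpullW
    apply Submodule.comap_injective_of_surjective Q.Φ_surjective
    rw [Q.comap_tangent, heq, Submodule.comap_bot, Q.ker_Φ]
  -- (T4) algebraic points with torsion abelian part; the quotient has `≤ 1` elliptic coordinates
  have h4 : Q.Φ w ∈ Std.AlgTors L Q.κM := Q.Φ_mem_AlgTors h₂ h₃ hwAlg
  have hγ : Fintype.card (Fin Q.nC) ≤ 1 := by
    rw [Fintype.card_fin]; exact le_trans Q.nC_le_card hκ
  have h5 := hstd _ _ _ Q.κM hγ W' h1 h2 h3 (Q.Φ w) (Submodule.mem_map_of_mem hwW) h4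
  -- (T5) lift the kernel
  obtain ⟨k, hk, hwk⟩ := Q.exists_ker_of_Φ_mem_ker h5
  exact ⟨k, hk, w - k, hwk, by abel⟩

end Transport

/-- **The analytic subgroup theorem at the period vectors of `𝔾ₐ × 𝔾ₘ^ι × (E♮)^κ`, `|κ| ≤ 1`,
over ONE lattice with algebraic invariants — complex multiplication allowed — from Philippon's
zero estimate for the `M_κ'` over that lattice with at most one elliptic factor** (hypothesis
`hZ`: the body of `philippon1986_std` at `L` for `|γ| ≤ 1`, where the obstruction list
`SubgroupDataC` is complete with or without CM). For `x` algebraic, `exp(yᵢ)` algebraic and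
`u = (x; y; z; t)` with `z_k = m_k ω₁ + n_k ω₂`, `t_k = m_k η₁ + n_k η₂`: if the coordinates of
`u` are `ℚ̄`-linearly dependent then `x = 0`, or the `yᵢ` are `ℤ`-dependent, or the `z_k` are
`ℤ`-dependent. Chain: `Std.hyperplane_tors_oneFactor_of_zeroEstimateAt` (induction over
borderline quotients and subgroups, `|γ| ≤ 1` preserved) → `hyperplaneTheorem_presTors_oneFactor`
(transport) → `GaGmE.periods_of_hyperplaneTheorem_presTors` (dévissage at the period vectors).
[cite: HuberWustholz2022, Thm. 6.2 (no CM restriction)] [cite: BakerWustholz2007, Thm. 6.1, Thm. 6.15, §6.8] [cite: Philippon1986, Thm 2.1] -/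
theorem periods_oneFactor_of_zeroEstimateAt {L : PeriodPair} (h₂ : IsAlgebraic ℚ L.g₂)
    (h₃ : IsAlgebraic ℚ L.g₃)
    (hZ : ∀ (β γ δ : Type) [Fintype β] [Fintype γ] [Fintype δ] [DecidableEq γ] (κM : δ → γ → Kbar),
      Fintype.card γ ≤ 1 →
      ∃ c : ℝ, 0 < c ∧ ∀ (𝔟 : Submodule ℂ (β ⊕ (γ ⊕ δ) → ℂ)) (v : β ⊕ (γ ⊕ δ) → ℂ)
        (P : MvPolynomial (Option β × Std.ThetaIdx γ δ) ℂ) (D S T : ℕ),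
        0 < Module.finrank ℂ 𝔟 → 1 ≤ D → 1 ≤ S → P.IsHomogeneous D →
        (∃ w, Std.thetaEval L κM P w ≠ 0) →
        (∀ s : ℕ, s ≤ Fintype.card (β ⊕ (γ ⊕ δ)) * S →
          Std.VanishesAlong 𝔟 (Std.thetaEval L κM P) ((s : ℂ) • v) (Fintype.card (β ⊕ (γ ⊕ δ)) * T + 1)) →
        ∃ K : Std.SubgroupDataC β γ δ κM,
          (∃ w₀, ∀ w ∈ K.tangent, Std.thetaEval L κM P (w₀ + w) = 0) ∧
          (Nat.choose (T + (Module.finrank ℂ 𝔟 - Module.finrank ℂ ↥(𝔟 ⊓ K.tangent)))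
              (Module.finrank ℂ 𝔟 - Module.finrank ℂ ↥(𝔟 ⊓ K.tangent)) : ℝ) *
            (Std.orbitCard L κM K v S : ℝ) * (D : ℝ) ^ Module.finrank ℂ K.tangent ≤
            c * (D : ℝ) ^ Fintype.card (β ⊕ (γ ⊕ δ)))
    {ι κ : Type} [Fintype ι] [Fintype κ] (hκ : Fintype.card κ ≤ 1)
    (x : ℂ) (y : ι → ℂ) (m n : κ → ℤ)
    (hx : IsAlgebraic ℚ x) (hy : ∀ i, IsAlgebraic ℚ (cexp (y i)))
    (hdep : ¬ QbarLinearIndependent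
      (lieCoords x y (fun k => (m k : ℂ) * L.ω₁ + (n k : ℂ) * L.ω₂)
        (fun k => (m k : ℂ) * L.η₁ + (n k : ℂ) * L.η₂))) :
    x = 0 ∨ (∃ p : ι → ℤ, p ≠ 0 ∧ ∑ i, (p i : ℂ) * y i = 0) ∨
      (∃ a : κ → ℤ, a ≠ 0 ∧ ∑ k, (a k : ℂ) * ((m k : ℂ) * L.ω₁ + (n k : ℂ) * L.ω₂) = 0) :=
  GaGmE.periods_of_hyperplaneTheorem_presTors h₂ h₃
    (hyperplaneTheorem_presTors_oneFactor L h₂ h₃ hκ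
      (Std.hyperplane_tors_oneFactor_of_zeroEstimateAt L h₂ h₃ hZ))
    x y m n hx hy hdep

end GaGmE

end Literature.NumberTheory.Transcendental

end
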